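import Summits.QuantumFields.YangMills.Theorems.BalabanUVNodesN12MinimiserFamilyOfClassThresholdUniform
import Summits.QuantumFields.YangMills.Theorems.BalabanUVNodesN12GaugeLetterLocExplicitOnZ

/-!
# DAG node N12 [B15] — THE onZ EDITION «U3-onZ» OF THE εreg-UNIFORM (J0′) PRODUCER WITH DATUM LETTERS (`…N12MinimiserFamilyOfClassDatumLettersUniform` = «U3», p725063): the (σ)_N letter of
# record is taken in dag-n12-w6 g18's onZ form `N12GaugeLetterLocExplicitOnZ.exists_gaugeLetterLoc_atRecord_explicit_onZ` — per base field the datum letter reads the `k`-bonds INSIDE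
# `Z^{(k)}` only; the instance-level region rows `𝒞 N hGN hN1 hGmem` are GONE

[Balaban1989LargeFieldII] = «[LF-II]», p. 357, (1.12)–(1.13) p. 359; [Balaban1989LargeFieldI] = «[IV]», (1.74) p. 192, p. 193 (the extension), p. 194 (the sentence after (1.77): the datum is
read on its gauge orbit), Prop. 1 p. 194; [Balaban1985Variational] = «[15]», (2)–(4) p. 278, Thm 1 p. 279, (16)–(18) p. 280, Sect. C (44)–(48) p. 285, (181) p. 307; [Balaban1985RegularSpaces]
(1.7) p. 77, (1.19) p. 79; [Balaban1985Averaging] = «[4]», Prop. 2 (52)–(53) p. 26, (122)–(126) p. 36; [Balaban1988Convergent] = «[III]», (1.3) p. 246, (2.2) p. 255, (2.10)–(2.13) pp. 256–257,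
(2.16) p. 257.

Cell `pub-ymgap`, HUMAN RULINGS D-0062 ∕ D-0149, lane owner `pub-ymgap-dag-n12-c` (g27, strategy s1).  Key K1⁹ `stmt-QuantumFields-27364`, `--kind proof --supports … --as helper`; count-neutral.
NEW leaf; CONSUMED BY NAME, nothing modified: `…N12MinimiserFamilyOfClassThresholdUniform` §3 (the residual-gauge form with `δ₀` first) and dag-n12-w6 g18's onZ (σ)_N letter of record
`N12GaugeLetterLocExplicitOnZ.exists_gaugeLetterLoc_atRecord_explicit_onZ` (p732020; stated for EVERY `ν`, here at `ν⟨εreg := εr⟩`).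

WHY — LOCATED-U3-GLOBAL (the lane, g27) = ⚑ LOCATED-DATUM-FAR (dag-n12-w6 g18), pub-ymgap INBOX 2026-08-29.  U3 keys on w3's GLOBAL explicit corner, whose shadow geometry letter `hGmem`
ranges at level `0` over EVERY bond touching `Ω₁(Z)ᶜ`; any admissible `𝒞` then contains the `k`-shadows of all exterior face-crossing bonds and the datum letter `∀ c ∈ 𝒞, dist1 ((ext V_k) c)
≤ ρn` asks the rough exterior datum to be flat — uninhabitable far from `Z` in ANY gauge (w6's holonomy witness: `V_k″ := 1` except `−1` on one `k`-bond off `Z`).  w6's cure (p731874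
`N12FarDatumSurgery`: (2.12) minimisers do not read the datum off `Z^{(k)}`; p732020: the (σ)_N letter with ONE datum hypothesis on the `k`-bonds inside `Z^{(k)}`) makes the letter live where
the guard lives.  THIS FILE is U3 re-keyed on it: `δ₀` first, the `εr` rows, the class facts, `ρn`, «`T(ρn, εr) ≤ δ₀`», then per base field (E) · datum plaquette regularity · the DATUM
LETTER ON `Z^{(k)}` · (T1@q₀) — U3 VERBATIM otherwise.  On the lane's orbit road (`B15Prop1MinimiserFamilyGaugeCovariance`, `B15Prop1MinimiserFamilyOfNormalisedSlice`) the onZ letter is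
inhabited from the knit's guard by dag-n12-w6's normalising gauge whenever the `k`-bonds inside `Z^{(k)}` lie in the region box — the direct road's BOX SCOPE, displayed there.

CONTENTS (namespace `Summit.QuantumFields.YangMills.BalabanUVNodes.N12MinimiserFamilyOfClassDatumLettersOnZUniform`; one theorem, no `def`, no `instance`, no `sorry`).
★★★ `hMin_atRecord_of_node00Letters_thm1AtBase_central_ofClass_datumLettersOnZ_uniform`.

HONEST FRAMING ∕ LOCATED.  Composition by name + binder order; (E) and (T1@q₀) remain [15] Thm 1's rows (fed from the lane's `B15Prop1Thm1RowsOfExistsUnique` by consumers); the datum letter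
is a gauge condition on `Z^{(k)}` (LOCATED-GEOM v3 scope for ring-like `Z`: no gauge flattens a datum with large holonomy — displayed); `δ₀` EXISTENTIAL per (instance, height); nothing of
Bałaban's estimates asserted; count-neutral helper; N12 NOT discharged; K1⁹ NOT closed; counts unmoved; one finite 𝕋⁴ programme at fixed ε — R4 closes the conditional finite-𝕋⁴ rung
`BalabanLadder.UV` only; NOT continuum ∕ OS ∕ mass gap ∕ Clay.
-/

noncomputable section

open scoped BigOperators Matrix.Norms.L2Operator Topology

namespace Summit.QuantumFields.YangMills.BalabanUVNodes.N12MinimiserFamilyOfClassDatumLettersOnZUniform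

open Set Metric Filter
open Literature.MathematicalPhysics.QuantumFieldTheory.Balaban1983to89
open Literature.MathematicalPhysics.QuantumFieldTheory.Balaban1983to89.Node00 (SU coeField coeField_apply SmallBelow ConstrSet constrCard constrEnum dIterL)
open T4Continuum B15DeterminingSets GaugeField
open B14.Eq213MaximalDomains (side)
open B14.Eq213DetSet (Bj Bj_of_gt Bj_zero maxDomT)
open B15Prop1Carrier (plaqsInside)
open B15AveragingHolomorphic (iterMh)
open B15ComplexifiedDatumFamily (conjVec)
open B15SU2ChartHolomorphic (genE expMulC logCoordC)
open B15Prop1AnalyticExtClause (cplxVec norm_cplxVec_apply)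
open B15Prop1ChartCalculusSU2 (E3)
open B15Prop1ChartSU2 (su2Chart)
open B15ShellGauge193 (shellGauge)
open B15Extension193 (extend)
open B16Sect1Backgrounds (toMS expMul)
open ExpMeanLog (expMeanLogSU)
open BlockAveraging (blockAvg)
open T4CubeChartGnomonic (SU2)
open Literature.MathematicalPhysics.QuantumFieldTheory.BalabanImbrieJaffe1984to88.BIJ85Eq453GaugeField (qsstarGIter0)
open Summit.QuantumFields.YangMills.BalabanUVNodes.N12MinimiserFamilyOfClassGaugeRow (hMin_atRecord_of_node00Letters_thm1AtBase_central_ofClass_gaugeRow)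
open Summit.QuantumFields.YangMills.BalabanUVNodes.N12MultiplierLetterOfClass (multiplierLetter_Bj_of_isMinimizer_class_of_curvatureLetter)
open Summit.QuantumFields.YangMills.BalabanUVNodes.N12HVelocityOfClass (hH_velocity_Bj_of_isMinimizer_class)
open B15Prop1MinimiserTowerAxialGauge (isMinimizer_gaugeAct_of_residual)
open B15Eq177ValueInvarianceCoDiv (gaugeAct_mem_regMSCoPOfRecord)
open B16Sect1Backgrounds (mulG gaugeAct_gaugeAct)
open B14Eq16FaddeevPopov (wilsonAction4_gaugeAct')
open Summit.QuantumFields.YangMills.BalabanUVNodes.N12SliceDatumCurvatureOfClass (exists_uniform_sliceDatum_curvatureLetter_of_class)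
open B5Eq118OneStroke (iterBlockOf)
open B14.Eq216Concrete (feeds)
open B15Eq112TorusCover (lift)
open T4AxialGaugeSmallField (boxPlaqs)
open T4AdjointCovarianceUnitary (lieSU)
open Node00 (msChart avOfRecord regMSCoPOfRecord)
open scoped Matrix.Norms.L2Operator

open Summit.QuantumFields.YangMills.BalabanUVNodes.N12MinimiserFamilyOfClassThresholdUniform (hMin_atRecord_of_node00Letters_thm1AtBase_central_ofClass_threshold_residual_uniform)
open Summit.QuantumFields.YangMills.BalabanUVNodes.N12GaugeLetterLocExplicitOnZ (exists_gaugeLetterLoc_atRecord_explicit_onZ)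
open ExpMeanLog (deltaSU)
open B14.Eq22Determines (blockIter)
variable {F : T4Family} {k : ℕ}

/-- ★★★ **V5u-onZ — THE (J0′) PRODUCER WITH THE DATUM LETTER ON `Z^{(k)}`, THRESHOLD FIRST.**  Instance-level: the capstone's record data + one forest + the (σ)_N level guard, radii ∕
support lower bounds on `M₁` (NO region rows); per height the radius letter at `ρ″ > 0`, `6(d−1)Lᵏ·δ ≤ ρ″`, dag-n12-w6's `hHB` at `(εH, B)`.  ANNOUNCED `∃ δ₀ > 0`.  THEN for every class
tolerance `εr > 0` (floors, [4]-Prop.-2 smallness), every closed `reg' ⊇ closure U_k({Ω_j(Z)}, εr)` with continuous constrained averages, every datum tolerance `ρn ≥ 0` with `T(ρn, εr) ≤ δ₀`,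
and per base field (E) · `PlaqSmallOn (plaqsInside (pts k Z)) δ (ext V_k)` · `∀ e, e.src ∈ pts k Z → e.tgt ∈ pts k Z → dist1 ((ext V_k) e) ≤ ρn` · (T1@q₀): the (J0′) conclusion VERBATIM at
the class `U_k({Ω_j(Z)}, εr)`.  Proof: `…_threshold_residual_uniform` at `δc := T(ρn, εr)`, the (σ, (δ)) row per base field from `exists_gaugeLetterLoc_atRecord_explicit_onZ` at
`ν⟨εreg := εr⟩`, `W := ext V_k`.
[cite: Balaban1989LargeFieldII, p.357, (1.12)–(1.13) p.359; Balaban1989LargeFieldI, (1.74) p.192, Prop. 1 p.194; Balaban1985Variational, (2)–(4) p.278, Thm 1 p.279, (16)–(18) p.280, Sect. C (44)–(48) p.285, (181) p.307; Balaban1985RegularSpaces, (1.7) p.77, (1.19) p.79; Balaban1985Averaging, Prop. 2 (52)–(53) p.26, (122)–(126) p.36; Balaban1988Convergent, (1.3) p.246, (2.2) p.255, (2.10)–(2.13) pp.256–257, (2.16) p.257] -/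
theorem hMin_atRecord_of_node00Letters_thm1AtBase_central_ofClass_datumLettersOnZ_uniform (ν : Node00.Stage7Numerics) (Kt : ℕ) (hd : 2 ≤ (F.P Kt).d) (Z : Set (Site (F.P Kt) 0)) (𝔹 : DetSet (F.P Kt)) (h𝔹Z : 𝔹 = Bj ν.M₁ Z k) (hkK : k + 1 ≤ (F.P Kt).m + (F.P Kt).K)
    (hM4 : 4 * (F.P Kt).L ≤ ν.M₁) (hdiv : side (F.P Kt).L ν.M₁ k ∣ (F.P Kt).sitesPerDir 0) (hZblk : B14.Eq22Determines.IsBlockUnion k Z)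
    {ρ'' : ℝ} (hsbU : ∀ W : GaugeField (F.P Kt) 0 SU2, ‖coeField W - 1‖ ≤ ρ'' → SmallBelow (Node00.avOfRecord F 2 Kt) k W)
    (hρ : 0 < ρ'')
    (hk0 : 0 < k)
    -- ONCE per height: the right-inverse letter of the real chart (dag-n12-w6's `hHB`, inhabited by `N12HsurjOfClass.exists_hsurjLetters`)
    {εH B : ℝ}
    (hHB : ∀ (Wd : MSField (F.P Kt) SU2) (U₀ : GaugeField (F.P Kt) 0 SU2),
      AgreeOn (Bj ν.M₁ Z k) (avgFamily (avOfRecord F 2 Kt) U₀) Wd →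
      (∀ i' : Fin (constrCard (Bj ν.M₁ Z k) k), ∃ U' : GaugeField (F.P Kt) 0 SU2,
        (∀ b ∈ feeds (((constrEnum (Bj ν.M₁ Z k) k).symm i').1 : ℕ) ((constrEnum (Bj ν.M₁ Z k) k).symm i').2.1, U' b = U₀ b) ∧
          SmallBelow (avOfRecord F 2 Kt) k U') →
      (∀ (j : ℕ), 1 ≤ j → j ≤ k → ∀ y : Site (F.P Kt) j, embIter j y ∈ maxDomT ν.M₁ Z j → ∃ U' : GaugeField (F.P Kt) 0 SU2,
        (∀ c : PBond (F.P Kt) j, (c.src = y ∨ c.tgt = y) → ∀ b₀ : PBond (F.P Kt) 0,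
          (iterBlockOf j b₀.src = c.src ∨ iterBlockOf j b₀.src = c.tgt) → (iterBlockOf j b₀.tgt = c.src ∨ iterBlockOf j b₀.tgt = c.tgt) → U' b₀ = U₀ b₀) ∧
        SmallBelow (avOfRecord F 2 Kt) k U') →
      (∀ (j : ℕ), 1 ≤ j → j ≤ k → ∀ y : Site (F.P Kt) j, embIter j y ∈ maxDomT ν.M₁ Z j →
        PlaqSmallOn (boxPlaqs (fun κ => lift (F.P Kt) (embIter j y) κ - ((((F.P Kt).L ^ j : ℕ) : ℤ) + ((((F.P Kt).L ^ j - 1) / 2 : ℕ) : ℤ)))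
          (fun κ => lift (F.P Kt) (embIter j y) κ + ((((F.P Kt).L ^ j : ℕ) : ℤ) + ((((F.P Kt).L ^ j - 1) / 2 : ℕ) : ℤ))) : Set (Plaq (F.P Kt) 0)) εH U₀) →
      ∃ H : (Fin (constrCard (Bj ν.M₁ Z k) k) → lieSU (Fin 2)) → PBond (F.P Kt) 0 → lieSU (Fin 2),
        (∀ v, fderiv ℝ (msChart F 2 Kt k (Bj ν.M₁ Z k) Wd U₀) 0 (H v) = v) ∧ ∀ v, Real.sqrt (∑ b, ‖H v b‖ ^ 2) ≤ B * ‖v‖) (hB0 : 0 ≤ B)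
    -- ONE forest and its axial slice per instance (dag-n12-w3's `N12ForestSlice.exists_forest_slice_Bj`): (F1), (F2), (TREE), (F3)
    (path : Site (F.P Kt) 0 → List (LStep (F.P Kt) 0)) (S : Submodule ℂ (VecField (F.P Kt) 0 (EuclideanSpace ℂ (Fin 3))))
    (hF1 : ∀ x, ∀ s ∈ path x, ∃ x' x'' : Site (F.P Kt) 0, path x'' = path x' ++ [s] ∧
        (s.fwd = true → s.bond.src = x' ∧ s.bond.tgt = x'') ∧ (s.fwd = false → s.bond.src = x'' ∧ s.bond.tgt = x'))
    (hF2 : ∀ j, j ≤ k → ∀ c ∈ bondsOf (𝔹 j), path (embIter j c.src) = [] ∧ path (embIter j c.tgt) = [])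
    (hTREE : ∀ x : Site (F.P Kt) 0, x ∉ {z : Site (F.P Kt) 0 | ∃ j, j ≤ k ∧ ∃ c ∈ bondsOf (𝔹 j), (z = embIter j c.src ∨ z = embIter j c.tgt)} →
      ∃ (x' : Site (F.P Kt) 0) (s : LStep (F.P Kt) 0), path x = path x' ++ [s] ∧
        (s.fwd = true → s.bond.src = x' ∧ s.bond.tgt = x) ∧ (s.fwd = false → s.bond.src = x ∧ s.bond.tgt = x'))
    (hF3 : ∀ X : VecField (F.P Kt) 0 (EuclideanSpace ℂ (Fin 3)), X ∈ S ↔ ∀ x, ∀ s ∈ path x, X s.bond = 0)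
    -- (σ)_N OF RECORD (dag-n12-w3's `N12GaugeLetterLocExplicit.exists_gaugeLetterLoc_atRecord_explicit`), instance-level letters VERBATIM:
    -- NUMERICS (i): a level guard `k + c ≤ m + K` with `4d + m′ + 3 < 2·L^c` (no wrapping), and `M₁ ≥ (4d + m′)·L² + 2d·L + 12` (radii), `m′ = 3·(d·((L−1)∕2)) + 5`
    {c : ℕ} (hkc : k + c ≤ (F.P Kt).m + (F.P Kt).K) (hc : 4 * (F.P Kt).d + (3 * ((F.P Kt).d * (((F.P Kt).L - 1) / 2)) + 5) + 3 < 2 * (F.P Kt).L ^ c)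
    (hMrad : (4 * (F.P Kt).d + (3 * ((F.P Kt).d * (((F.P Kt).L - 1) / 2)) + 5)) * (F.P Kt).L ^ 2 + 2 * (F.P Kt).d * (F.P Kt).L + 12 ≤ ν.M₁)
    -- the family's support numerics: `M₁ ≥ ((d+4)L + 6)·L²`
    (hM₁ : (((F.P Kt).d + 4) * (F.P Kt).L + 6) * (F.P Kt).L ^ 2 ≤ ν.M₁) :
    -- THE GAUGE-TOLERANCE THRESHOLD `δ₀`, announced before the base fields; the (σ)_N tolerance of record must sit below it
    ∃ δ₀ : ℝ, 0 < δ₀ ∧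
    -- THE WINDOW, THE DATUM's REGULARITY TOLERANCE, THE EXTENSION, THE COMPACT PARAMETER SET AND THE BOUND — ALL AFTER THE CONSTANTS
    ∀ (Λ : Set (Site (F.P Kt) k)) (lo hi : Fin (F.P Kt).d → ℤ) {δ : ℝ}, 0 < δ → 6 * ((((F.P Kt).d - 1 : ℕ)) : ℝ) * (F.P Kt).L ^ k * δ ≤ ρ'' →
    ∀ (ext : GaugeField (F.P Kt) k SU2 → GaugeField (F.P Kt) k SU2), (∀ W, ext W = extend Λ (shellGauge W lo hi) W) →
    ∀ {K : Set (GaugeField (F.P Kt) k SU2)}, IsCompact K → ∀ {𝓐₀ : ℝ}, 1 < 𝓐₀ →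
    -- THE CLASS TOLERANCE (positive, [4]-Prop.-2-small, below the floors), THE CLASS FACTS, THE DATUM TOLERANCE — ALL AFTER THE THRESHOLD (`ν⟨εreg := εr⟩`, `M₁` unchanged)
    ∀ (εr : ℝ), 0 < εr → 12 * ((((F.P Kt).d - 1 : ℕ)) : ℝ) * (F.P Kt).L * εr ≤ ρ'' → εr ≤ εH →
    (143 * (((((F.P Kt).d + 4 : ℕ) : ℝ)) ^ 2 / 4) ^ 2) * (εr * (F.P Kt).L ^ 2) ≤ 1 / 3 →
    2 * (εr * (F.P Kt).L ^ 2) ≤ 2 * deltaSU (Fin 2) / ((((F.P Kt).d + 4) * (F.P Kt).L : ℕ) : ℝ) ^ 2 →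
    (((((F.P Kt).d + 2) * (F.P Kt).L : ℕ) : ℝ) ^ 2 / 4) * (2 * (εr * (F.P Kt).L ^ 2)) < deltaSU (Fin 2) →
    ∀ (reg' : Set (GaugeField (F.P Kt) 0 SU2)), IsClosed reg' → closure (Node00.regMSCoPOfRecord F 2 {ν with εreg := εr} Kt k (maxDomT ν.M₁ Z)) ⊆ reg' →
      ContinuousOn (fun (U : GaugeField (F.P Kt) 0 SU2) (i : Fin (constrCard 𝔹 k)) =>
        ((avgFamily (Node00.avOfRecord F 2 Kt) U ((constrEnum 𝔹 k).symm i).1 ((constrEnum 𝔹 k).symm i).2.1 : SU2) : Matrix (Fin 2) (Fin 2) ℂ)) reg' →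
    ∀ {ρn : ℝ}, 0 ≤ ρn →
    ((max ρn ((((2 * (∑ i ∈ Finset.range (k + 1), ((F.P Kt).d * (((F.P Kt).L ^ i - 1) / 2) + 1)) + 1 +
                  (3 * ((F.P Kt).d * (((F.P Kt).L - 1) / 2)) + 5) * (F.P Kt).L ^ k : ℕ) : ℝ)) ^ 2 / 4 * (εr * (F.P Kt).eta 0 ^ 2) +
                ((3 * ((F.P Kt).d * (((F.P Kt).L - 1) / 2)) + 5 : ℕ) : ℝ) * (6 * ((((((F.P Kt).d + 2) * (F.P Kt).L : ℕ) : ℝ) ^ 2 / 4) * (2 * (εr * (F.P Kt).L ^ 2))) * ∑ i ∈ Finset.range k, ((F.P Kt).L : ℝ) ^ i) + ((3 * ((F.P Kt).d * (((F.P Kt).L - 1) / 2)) + 5 : ℕ) : ℝ) * ρn) ≤ δ₀) →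
    (∀ Vk ∈ K, ∃ U₀ : GaugeField (F.P Kt) 0 SU2,
      IsMinimizer (Node00.avOfRecord F 2 Kt) (Node00.regMSCoPOfRecord F 2 {ν with εreg := εr} Kt k (maxDomT ν.M₁ Z)) 𝔹
        (avgFamily (Node00.avOfRecord F 2 Kt) (qsstarGIter0 k (ext Vk))) U₀ ∧
      PlaqSmallOn (plaqsInside (pts k Z)) δ (ext Vk) ∧
      -- THE DATUM LETTER ON `Z^{(k)}` (dag-n12-w6 g18's onZ producer): `ext V_k` is `ρn`-flat on the `k`-bonds INSIDE `Z^{(k)}`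
      (∀ e : PBond (F.P Kt) k, e.src ∈ pts k Z → e.tgt ∈ pts k Z → dist1 ((ext Vk) e) ≤ ρn) ∧
      -- (T1@q₀) — the capstone's row verbatim
      (∀ U ∈ reg', AgreeOn 𝔹 (avgFamily (Node00.avOfRecord F 2 Kt) U) (avgFamily (Node00.avOfRecord F 2 Kt) (qsstarGIter0 k (ext Vk))) →
        wilsonAction4 U ≤ wilsonAction4 U₀ →
          ∃ u : GaugeTransf (F.P Kt) 0 SU2, (∀ j, j ≤ k → ∀ b ∈ bondsOf (𝔹 j), toMS u j b.src = toMS u j b.tgt ∧ ∀ g : SU2, toMS u j b.src * g = g * toMS u j b.src) ∧ gaugeAct u U = U₀)) →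
    ∃ R : ℝ, 0 < R ∧ ∀ Vk ∈ K,
      ∃ Ũ : VecField (F.P Kt) k (EuclideanSpace ℂ (Fin 3)) × VecField (F.P Kt) k (EuclideanSpace ℂ (Fin 3)) → PBond (F.P Kt) 0 → Matrix (Fin 2) (Fin 2) ℂ,
        (∀ b i j, DifferentiableOn ℂ (fun z => Ũ z b i j) (ball 0 R)) ∧
        (∀ z ∈ ball (0 : VecField (F.P Kt) k (EuclideanSpace ℂ (Fin 3)) × VecField (F.P Kt) k (EuclideanSpace ℂ (Fin 3))) R, ∀ b i j, ‖Ũ z b i j‖ ≤ 𝓐₀) ∧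
        ∀ p B' : VecField (F.P Kt) k E3, ‖p‖ < R → ‖B'‖ < R → ∃ U' : GaugeField (F.P Kt) 0 SU2,
          (∀ b, Ũ (cplxVec p, cplxVec B') b = ((U' b : SU2) : Matrix (Fin 2) (Fin 2) ℂ)) ∧
            IsMinimizer (Node00.avOfRecord F 2 Kt) (Node00.regMSCoPOfRecord F 2 {ν with εreg := εr} Kt k (maxDomT ν.M₁ Z)) 𝔹
              (avgFamily (Node00.avOfRecord F 2 Kt) (qsstarGIter0 k (expMul su2Chart B' (ext (expMul su2Chart p Vk))))) U')
:= by
  obtain ⟨δ₀, hδ₀, h⟩ := hMin_atRecord_of_node00Letters_thm1AtBase_central_ofClass_threshold_residual_uniform ν Kt hd Z 𝔹 h𝔹Z hkK hM4 hdiv hZblk hsbU hρ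
    hk0 hHB hB0 path S hF1 hF2 hTREE hF3
  refine ⟨δ₀, hδ₀, fun Λ lo hi {δ} hδ hδρ ext hext {K} hK {𝓐₀} h𝓐₀ εr hεpos hερ hεH hα3 hα2 haN reg' hreg' hcl hDreg' {ρn} hρn hT hbase =>
    h Λ lo hi hδ hδρ ext hext hK h𝓐₀ εr hεpos.le hερ hεH reg' hreg' hcl hDreg' ?_ hT fun Vk hVk => ?_⟩
  · exact le_trans hρn (le_max_left _ _)
  obtain ⟨U₀, hmin, hreg, hD, hT1⟩ := hbase Vk hVk
  subst h𝔹Z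
  have hk : k ≤ (F.P Kt).m + (F.P Kt).K := Nat.le_of_succ_le hkK
  obtain ⟨σ, hσ, hNF, -⟩ := exists_gaugeLetterLoc_atRecord_explicit_onZ {ν with εreg := εr} Kt hk0 hk hdiv Z hZblk hkc hc hMrad hρn (ext Vk) hD hmin
    hεpos hα3 hα2 haN hM₁
  exact ⟨U₀, σ, hmin, hreg, hσ, hNF, hT1⟩

end Summit.QuantumFields.YangMills.BalabanUVNodes.N12MinimiserFamilyOfClassDatumLettersOnZUniform

end
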